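import Literature.MathematicalPhysics.QuantumFieldTheory.Balaban1983to89.T4InsertionProfile
import Mathlib.MeasureTheory.Integral.Bochner.Basic

/-!
# T4TerritoryComparison — row T4-U5.E-a-E2REL-b° (T4-DAG v8 §5, carver priority (1)): the TERRITORY CONDITIONAL
COMPARISON half (b) of the relative-locality lemma E2-rel, typed as a FIBREWISE (conditional-on-exterior-data) lower /
two-sided bound on the context's small-field integral over a pending component's territory against the reference
normalisation the pending operation divides out, with the d′-relative, K-uniform cost currency of the cell's referee
record built in and the final-step Haar-vs-Gaussian normalisation mismatch carried as an explicit NAMED SLACK (not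
asserted to cancel); plus the kernel bookkeeping «(F1) printed absolute own-factor bound ∧ E2-rel (a) ∧ E2-rel (b) ⇒
`T4InsertionProfile.PointwiseRatio`» by monotonicity of the fibre integral (cell `pub-balaban`, T4-DAG node U5c / NE7b;
estimate cell EST: typed located hypothesis with constants + kernel bookkeeping; the comparison itself is NOT
kernel-proved and NOT printed — see below)

HONEST FRAMING (cell `pub-balaban`, T4-DAG PAGE 1).  The cell's T4 target is the existence AND uniqueness of the
continuum limit of Bałaban's unit-scale averaged loop expectations on a FIXED finite torus — strictly beyond ultraviolet
stability ([Balaban1989LargeFieldII] Thm 1 p. 355); it is NOT the Yang–Mills mass gap and NOT the Clay problem.  This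
module serves ONE half of ONE clause of the cell's own uniqueness spine: the single-slot insertion ratio (EN) of
`T4InsertionProfile.PointwiseRatio` (node U5c, weight bound NE7b) factors, in the representation (1.104), into the
pending structure's OWN factor (printed, absolute), an EXTERIOR relative-locality factor (E2-rel (a), not printed) and a
TERRITORY conditional comparison (E2-rel (b), not printed) — this file types the last one and proves only the
recombination.  Nothing of Bałaban's is asserted: every «…» below was READ BY THIS SEAT ON THE RENDERED JOURNAL PAGE
(PNG ×2, read as an image) and is quoted for CONTEXT, SHAPE AND LOCATION ONLY; the hypothesis shapes of §2
(`OwnFactorBound`, `ExteriorRelLocality`, `TerritoryLowerBound`, `TerritoryComparison`) are consumed only as hypotheses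
and are flagged PRINTED-IN-ABSOLUTE-FORM resp. NOT PRINTED.  Value = typed located hypothesis + kernel bookkeeping, NOT
an estimate of Bałaban's expansion, NOT summit progress.

CITATION HEADER (renders `b2b-balaban-ref1/pages/<dir>/<dir>-pNNN-x2.png`, NNN = PDF page).
* [Balaban1989LargeFieldII] = T. Bałaban, *Large field renormalization. II. Localization, exponentiation, and bounds for
  the ℝ operation*, Commun. Math. Phys. **122** (1989) 355–392 (cell paper B16; PDF page = journal page − 354; dir
  `1989-cmp122-large-field-II`; pages p024, p025, p026, p037, p038 read by this seat).
  p. 378/379 [p024/p025] (1.71), the pending operation `T′_k(X)`: the last line of its exponent reads «+ E_k(X) +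
  (−½d(g) log g_k^{−2} + log σ₀)|(B₀∖T₀) ∩ X| − E_k(Λ ∩ X)]», with «E_k(Z) denotes the sum of normalization terms and
  vacuum energy terms with localizations intersecting the large field domain Z» and «All the expressions in the above
  integral operation are localized in the domain X.» — the REFERENCE NORMALISATION the operation divides out (`norm`).
  p. 380 [p026] (1.73)–(1.75): «|T′_k(X,(U,J))F| = |T′_k(X,(U,0))e^σF| ≤ T′_k(X,(U,0))|e^σF| ≤ (T′_k(X,(U,0))1) sup
  e^{|σ|}|F|, (1.73)  |T′_k(X,(U,J))1| = |T′_k(X,(U,0))e^σ| ≥ T′_k(X,(U,0))e^{−2|σ|} ≥ (T′_k(X,(U,0))1)e^{−2sup|σ|},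
  (1.74)» and «The expression T′_k(X,(U,0))1 is obviously positive, although it may be very small, hence T′_k(X,(U,J))1
  ≠ 0»; then the COST CURRENCY: «Similar bounds hold for vacuum energy counterterms and normalization constants, except
  that for the last we have the corresponding constant O(log g_j^{−2}) instead of O(1). In effect we get a bound, to
  which every large field domain Z_j contributes the constant O(1) log g_j^{−2}|Z_j| ≤ O(1) log g_j^{−2}(MR_j)^d
  d′_j(Z_j) ≤ O(1)M^dR_j^{d+1}d′_j(Z_j), where d′_j is the linear size defined in terms of MR_j-cubes instead of
  M-cubes.» (a per-site normalisation mismatch is PAID, d′-relatively, at the step where the domain is integrated —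
  the currency of `cost` and of `volumeSlack_le_dPrime` below).
  p. 391 [p037] (1.103)/(1.104): «∏_{i=1}^m (T′_k(Y_i)1)[∏_{i=1}^m (T′_k(Y_i)1)^{−1}T′_k(Y_i) exp ΣB′^{(k)}(X)],
  (1.103)», «using the fact that the T′_k-operations are normalized, i.e., if such an operation is applied to a function
  which does not depend on the integration variables connected with the operation, then it is equal to 1» (a
  TAUTOLOGY of the quotient, not a comparison with a reference Gaussian), «there are no summations over these domains,
  they are fixed», and the representation «ℝρ_k = Σ_{Z_k} Σ_{{Y_1,…,Y_m}} χ_k(Σ_{{Ω^c_j,Z_j}} T″_k(Z_k)) ∏_{i=1}^m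
  χ^c_k(Y_i^{~−6})χ_{k,Λ_i}χ_iδ_{G_i}(V_kV_{Λ_i}^{−1})(T′_k(Y_i)1) · exp[A′_k + Σ_X ℝ′^{(k)}(X) + Σ_X B′^{(k)}(X)].
  (1.104)».
  p. 392 [p038]: «the functions T′_k(Y_i)1 multiplying the action density … These functions depend only on the new field
  variables V_k restricted to Y_i … The action is also simple; it is the usual small field action outside Z_k, with the
  additional boundary terms with localization domains containing one of the domains Y_i. The contributions from the
  previous large field regions is isolated in these boundary terms, and in the functions T′_k(Y_i)1.» — so the
  "exterior data" a pending factor sees are the new fields on and next to its territory (`Ω` below), and what a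
  deletion changes in the context are the terms whose localizations meet the territory (`extWith` / `extWithout`).
* [Balaban1988Convergent] = T. Bałaban, *Convergent renormalization expansions for lattice gauge theories*, Commun.
  Math. Phys. **119** (1988) 243–285 (cell paper B14 = [III] of B16; PDF page = journal page − 242; dir
  `1988-cmp119-convergent-renormalization`; pages p021, p022 read by this seat).
  p. 263 [p021] Theorem 2: «there exists a constant E₁ independent of j, k, Ω, {Ω_j}, {Λ_j}, T …» with (2.43)
  «|Σ_{z∈Λ⁰_j∩Ω}[E^{(j)}(Λ_j, U_k, z) − E^{(j)}(Λ_j, 1, z)] − β_j(g_{j−1})A(φ, U_k)| ≤ E₁ Σ_{n=j}^{k}(L^{j−n})^β|Γ_n ∩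
  Ω|» and (2.44) «|Σ_{X∈D_j, X⊂Λ_j, X∩Ω≠∅}[ℝ^{(j)}(X, U_k) − ℝ^{(j)}(X, 1)]| ≤ R₁g_j^{κ₀}Σ_{n=j}^{k}|Γ_n ∩ Ω|» — the
  printed LOCALIZED, UNIFORM, TWO-SIDED bounds on the action terms meeting a domain (the type of E2-rel (a)'s input; they
  bound an EXPONENT, not a conditional integral).
  p. 264 [p022]: «Thus we estimate the integral ∫dV_kρ_k by a sum of terms similar to the one considered in Sect. 3 [6],
  e.g., see (3.42).» and Corollary 3 (2.50): «there exist constants E_−, E_+ independent of η and T, but depending on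
  g_k, such that χ_k(T_η)exp[−(1/g_k²)A(U_k(V_k)) − E_−|T_η|] ≤ ρ_k(V_k) ≤ e^{E_+|T_η|}» — the printed lower bound is
  GLOBAL (whole torus), on the everywhere-small-field event, with g_k-dependent constants; NOT conditional, NOT per
  territory.
* [Balaban1982Higgs2] = T. Bałaban, *(Higgs)₂,₃ quantum fields in a finite volume. II. An upper bound*, Commun. Math.
  Phys. **86** (1982) 555–594 (= [6] of [I]; dir `1982-cmp86-higgs23-II`, p038 read): p. 592 (3.42) «Σ_{Λ₀^{(0)},…,
  Λ₀^{(K−1)}} ∏_{k=0}^{K−1} ζ″_{Λ₀^{(k)}} · exp(Σ_{k=0}^{K} O(1)(L^kε)^{κ₀}|Λ₇^{(k−1)′} ∩ Λ₇^{(k)c}|) · exp(Σ_{k=0}^{K}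
  O(1)|Λ₅^{(k−1)′} ∩ Λ₅^{(k)c}|) ≤ exp(O(1)|T_ε|)» and «The proof is purely combinatoric and model-independent.» — a
  whole-torus SUM OVER HISTORIES; territories in (1.104) are fixed, so (3.42) is not the conditional statement either.
* [Balaban1987RG1] = T. Bałaban, *Renormalization group approach to lattice gauge field theories. I*, Commun. Math.
  Phys. **109** (1987) 249–301 (B12 = [I]; dir `1987-cmp109-rg-I-small-field`, p012 read): p. 260 (1.3) «A_k(U_k) =
  −(1/g_k²)A(U_k) + Σ_{j=0}^{k−1}{−β_{j+1}(g_j)A(U_k) + [log Z^{(j)}(U_k) − log Z^{(j)}(1)] + [E^{(j+1)}(g_j, U_k) −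
  E^{(j+1)}(g_j, 1)]}» and (1.4) «Z^{(j)}(U_k) = ∫dB δ(Q̃B) exp[−½⟨B, Δ^{(j)}(U_k)B⟩]» («the Gaussian integral
  normalizing the Gaussian measure for a fluctuation field in j-th step integration») — the printed small-field
  normalisation is BY SUBTRACTION AT THE TRIVIAL CONFIGURATION, scale by scale, globally.
  WHAT THESE PAGES DO NOT PRINT (and this module does NOT assert) — E2-rel (b), in one display: for a pending
  structure 𝒵 born at slot i = (j, c) with layered territories 𝒵_n (n = j … K) and context history τ″ = off_i τ, and
  for (almost) every exterior datum ω (all integration variables other than those the operation T′(𝒵) integrates —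
  in particular the new fields V on and next to the territory),
      e^{−c_b·Σ_{n=j}^{K} M^dR_n^{d+1}(d′_n(𝒵_n)+1) − m(𝒵)} · N_𝒵(ω) ≤ I_{τ″,𝒵}(ω) [ ≤ e^{+c_b·Σ…+m(𝒵)} · N_𝒵(ω) ],
  where I_{τ″,𝒵}(ω) is the context's (small-field, steps j … K) integral over the territory's variables GIVEN ω,
  N_𝒵(ω) = exp of the normalisation / vacuum-energy terms that (1.71) inserts for X = 𝒵 (the reference the pending
  operation divides out), c_b = O(1) INDEPENDENT of K, of the run, of t, of τ″ and of ω, and m(𝒵) ≥ 0 is the final-step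
  Haar-vs-Gaussian normalisation mismatch of the territory (named slack; print's own treatment of such a mismatch,
  p. 380, pays it as O(log g^{−2}) per site ≤ O(1)M^dR^{d+1}d′ — d′-relative — which is hypothesis `SlackDPrime` here,
  not an assertion).  Why it might fail: conditioning on ω breaks the translation / reflection structure that makes the
  GLOBAL normalisation (1.3)/(2.50) computable; near the small-field thresholds of the exterior collar the conditional
  Gaussian mass of the territory's small-field event need not be bounded below uniformly per site.
* [King1986] = C. King, Commun. Math. Phys. **102** (1986) 649–677, (3.10) p. 656 — the printed MODEL of a matched
  part plus a large-field complement bounded by weight (quoted in `T4WeightBudget`); CONTEXT ONLY.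

THE POINT.  `T4InsertionProfile.PointwiseRatio Φ A shape y` asks `A τ ≤ y i (shape i τ) · A (off i τ)` for every term
pending at slot `i` — ONE history against the SAME history with the structure deleted.  Both weights are integrals of
non-negative integrands against the SAME underlying measure (histories come from decompositions of unity under one
integral, (1.104)), so after integrating the territory's own variables first they are integrals over common EXTERIOR DATA
`ω` of fibre densities (`FibreModel`, §1); a FIBREWISE domination `dens τ ω ≤ y · dens (off i τ) ω` integrates to (EN)
(`pointwiseRatio_of_fibrewise` — monotonicity of the Bochner integral, with the integrability binder the typing
checklist demands).  §2 factors the two fibre densities near the territory (`TerritoryFactorisation`: common far factor ×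
exterior terms meeting the territory × [reference normalisation × own factor] resp. × [territory integral]; the
factor functions are definable tautologically, `TerritoryFactorisation.ofFibrewise` / `territory_of_fibrewise`:
the split loses nothing — the CONTENT is in the three inequalities) and proves
`fibrewise_of_territory` / `pointwiseRatio_of_territory`: (F1) `OwnFactorBound` (own ≤ w_abs(s)·e^{c_g·cost(s)}: the
TYPE of the printed (1.79)/(1.89), absolute, per component, uniform in ω) ∧ `ExteriorRelLocality` (E2-rel (a): extWith ≤
e^{c_a·cost}·extWithout, NOT PRINTED; input type (2.43)/(2.44)) ∧ `TerritoryLowerBound` (E2-rel (b): e^{−(c_b·cost +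
slack)}·norm ≤ terr, NOT PRINTED) ⇒ (EN) with the context-free price `y i s = w_abs i s · exp((c_g + c_a + c_b)·cost i s
+ slack i s)`; `SlackDPrime` (slack ≤ c_m·cost) folds the mismatch into the d′-budget (`pointwiseRatio_of_territory_dPrime`,
price `w_abs·exp((c_g + c_a + c_b + c_m)·cost)`), and `volumeSlack_le_dPrime` is p. 380's two-step conversion
«O(1) log g^{−2}|Z| ≤ … ≤ O(1)M^dR^{d+1}d′» as arithmetic (volume ≤ (MR)^d(d′+1), log g^{−2} ≤ R).  `dPrimeCost` is the
cell's currency Σ_{n=j}^{K} M^dR_n^{d+1}(d′_n+1) (the debit of κ_{j+1}(Z) on p. 386, record t4/T4-REF-U5.md §8).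
§3 SANITY: the independent-structure model of `T4HistoryPeeling` §5 over a one-point exterior (Dirac fibre) carries a
territory factorisation in which (a) and (b) hold with EQUALITY and zero cost (`pointwiseRatio_product_territory`), so the
hypothesis set is inhabited non-vacuously and the recombined price is exactly the slot activity.

Sources.  [Balaban1989LargeFieldII] pp. 378–380, 391–392; [Balaban1988Convergent] pp. 263–264; [Balaban1982Higgs2]
p. 592; [Balaban1987RG1] p. 260 — CONTEXT / LOCATION ONLY as above; [King1986] — CONTEXT ONLY.  Everything proved below
is elementary real analysis (monotonicity of the integral) and finite bookkeeping. [folklore]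
Unit `b2b-balaban-pv06` gen 9 (journal CLAIM T4-U5.E-a-E2REL-b° 2026-08-19T01:43:57Z; the U5 referee lineage, records
t4/T4-REF-U5.md v1.3 §8 (Q21: d′-relative, K-uniform currency) and t4/T4-EST-U5Ea-E2relb.md); imports
`T4InsertionProfile` (pv14 lineage: `PointwiseRatio`, `SwitchOff`) and modifies nothing.
-/

open MeasureTheory

namespace Literature.MathematicalPhysics.QuantumFieldTheory.Balaban1983to89.T4TerritoryComparison

open T4HistoryPeeling T4InsertionProfile

/-! ## §1 Fibre models: weights as integrals over exterior data; fibrewise domination integrates to (EN) -/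

section Fibre

variable {ι : Type*} {T : Finset ι} {n : ℕ} {σ : Type*} {Ω : Type*} [MeasurableSpace Ω]

/-- **FIBRE MODEL (modelling shape).**  The weights `A τ`, `τ ∈ T`, are Bochner integrals over a common space `Ω` of
EXTERIOR DATA against one measure `μ` of non-negative, integrable fibre densities `dens τ`.  Cell reading of (1.104)
p. 391 / p. 392: all histories are terms of one decomposition of unity under the same field integral; `ω ∈ Ω` = every
integration variable except those the pending operation of the slot under discussion integrates (in particular the new
fields `V_k` on and next to the territory, on which «the functions T′_k(Y_i)1» depend); `dens τ ω` = the integral over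
the remaining (territory) variables given `ω` (Tonelli).  The integrability binder is the typing checklist's (no junk
integrals). [folklore] -/
structure FibreModel (T : Finset ι) (A : ι → ℝ) (μ : Measure Ω) where
  /-- fibre density of term `τ` over exterior datum `ω` -/
  dens : ι → Ω → ℝ
  /-- the weight is the fibre integral -/
  repr : ∀ τ ∈ T, A τ = ∫ ω, dens τ ω ∂μ
  /-- fibre densities are integrable -/
  integrable : ∀ τ ∈ T, Integrable (dens τ) μ
  /-- … and non-negative -/
  nonneg : ∀ τ ∈ T, ∀ ω, 0 ≤ dens τ ω

/-- **FIBREWISE (CONDITIONAL) INSERTION RATIO (hypothesis shape; NOT PRINTED).**  For every term `τ` pending at slot `i`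
and EVERY exterior datum `ω`: `dens τ ω ≤ y i (shape i τ) · dens (off i τ) ω` — the insertion ratio holds conditionally
on the exterior data with a context-free, ω-free price.  This is (EN) "before integrating the exterior", i.e. uniform in
the conditioning; §2 obtains it from the territory factorisation. [folklore] -/
def FibrewiseRatio (Φ : SwitchOff T n) {A : ι → ℝ} {μ : Measure Ω} (F : FibreModel T A μ)
    (shape : Fin n → ι → σ) (y : Fin n → σ → ℝ) : Prop :=
  ∀ i : Fin n, ∀ τ ∈ T, Φ.pend i τ = true → ∀ ω, F.dens τ ω ≤ y i (shape i τ) * F.dens (Φ.off i τ) ω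

/-- **FIBREWISE ⇒ POINTWISE**: a conditional ratio bound uniform in the exterior data integrates to
`T4InsertionProfile.PointwiseRatio` (monotonicity of the Bochner integral; the dominating side `y · dens (off i τ)` is
integrable, the dominated side non-negative). [folklore] -/
theorem pointwiseRatio_of_fibrewise (Φ : SwitchOff T n) {A : ι → ℝ} {μ : Measure Ω} (F : FibreModel T A μ)
    {shape : Fin n → ι → σ} {y : Fin n → σ → ℝ} (h : FibrewiseRatio Φ F shape y) :
    PointwiseRatio Φ A shape y := by
  intro i τ hτ hp
  have hoff : Φ.off i τ ∈ T := Φ.off_mem i τ hτ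
  rw [F.repr τ hτ, F.repr (Φ.off i τ) hoff, ← integral_const_mul]
  exact integral_mono_of_nonneg (Filter.Eventually.of_forall (F.nonneg τ hτ))
    ((F.integrable _ hoff).const_mul _) (Filter.Eventually.of_forall (h i τ hτ hp))

/-- Prices may be enlarged in (EN) when the context weights are non-negative. [folklore] -/
theorem pointwiseRatio_mono (Φ : SwitchOff T n) {A : ι → ℝ} (hA : ∀ τ ∈ T, 0 ≤ A τ) {shape : Fin n → ι → σ}
    {y y' : Fin n → σ → ℝ} (hyy : ∀ i, ∀ τ ∈ T, Φ.pend i τ = true → y i (shape i τ) ≤ y' i (shape i τ))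
    (h : PointwiseRatio Φ A shape y) : PointwiseRatio Φ A shape y' :=
  fun i τ hτ hp => (h i τ hτ hp).trans
    (mul_le_mul_of_nonneg_right (hyy i τ hτ hp) (hA _ (Φ.off_mem i τ hτ)))

end Fibre

/-! ## §2 The territory factorisation and the three located inequalities (F1) / E2-rel (a) / E2-rel (b) -/

section Territory

variable {ι : Type*} {T : Finset ι} {n : ℕ} {σ : Type*} {Ω : Type*} [MeasurableSpace Ω]

/-- **TERRITORY FACTORISATION (modelling shape).**  For a term `τ` pending at slot `i` with context `off i τ`, the two
fibre densities factor over the exterior datum `ω` as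
`dens τ ω = common · extWith · (norm · own)` and `dens (off i τ) ω = common · extWithout · terr`, all factors `≥ 0`:
`common` = the factors whose localizations miss the territory (identical in both histories); `extWith` / `extWithout` =
the exterior terms whose localizations MEET the territory («the additional boundary terms with localization domains
containing one of the domains Y_i» p. 392, resp. the ordinary small-field terms there); `own` = the pending structure's
own normalised factor («(T′_k(Y_i)1)» of (1.104), a function of «V_k restricted to Y_i»); `norm` = the reference
normalisation (1.71) divides out («E_k(X) … − E_k(Λ ∩ X)», «sum of normalization terms and vacuum energy terms with
localizations intersecting the large field domain»); `terr` = the context's small-field integral over the territory's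
variables given `ω`.  The factor functions can be DEFINED tautologically from the two densities; the located, unprinted
content is in `ExteriorRelLocality` and `TerritoryLowerBound` below, the printed content (in absolute form) in
`OwnFactorBound`. [folklore] -/
structure TerritoryFactorisation (Φ : SwitchOff T n) {A : ι → ℝ} {μ : Measure Ω} (F : FibreModel T A μ) where
  /-- factors with localizations away from the territory (common to both histories) -/
  common : Fin n → ι → Ω → ℝ
  /-- exterior terms meeting the territory, in the history WITH the structure -/
  extWith : Fin n → ι → Ω → ℝ
  /-- exterior terms meeting the territory, in the context (structure deleted) -/
  extWithout : Fin n → ι → Ω → ℝ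
  /-- the reference normalisation of the territory that the pending operation divides out -/
  norm : Fin n → ι → Ω → ℝ
  /-- the pending structure's own (normalised) factor -/
  own : Fin n → ι → Ω → ℝ
  /-- the context's conditional small-field integral over the territory -/
  terr : Fin n → ι → Ω → ℝ
  common_nonneg : ∀ i, ∀ τ ∈ T, ∀ ω, 0 ≤ common i τ ω
  extWithout_nonneg : ∀ i, ∀ τ ∈ T, ∀ ω, 0 ≤ extWithout i τ ω
  norm_nonneg : ∀ i, ∀ τ ∈ T, ∀ ω, 0 ≤ norm i τ ω
  own_nonneg : ∀ i, ∀ τ ∈ T, ∀ ω, 0 ≤ own i τ ω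
  /-- the history with the structure -/
  dens_pend : ∀ i, ∀ τ ∈ T, Φ.pend i τ = true → ∀ ω,
    F.dens τ ω = common i τ ω * extWith i τ ω * (norm i τ ω * own i τ ω)
  /-- the context -/
  dens_off : ∀ i, ∀ τ ∈ T, Φ.pend i τ = true → ∀ ω,
    F.dens (Φ.off i τ) ω = common i τ ω * extWithout i τ ω * terr i τ ω

variable (Φ : SwitchOff T n) {A : ι → ℝ} {μ : Measure Ω} {F : FibreModel T A μ} (X : TerritoryFactorisation Φ F)
  (shape : Fin n → ι → σ) (cost : Fin n → σ → ℝ)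

/-- **(F1) OWN-FACTOR BOUND (hypothesis shape; the TYPE of the PRINTED absolute bounds (1.79) p. 383 / (1.89) p. 387 on
`T′_k(X)1` — per component, uniform in the exterior data, a decay part `wabs` times a growth part exponential in the
d′-cost «sup exp{Σ_j O(1)M^dR_j^{d+1}d′_j(Z_j)}»; banking the event slack into `wabs` is the cell's R1, NOT PRINTED as a
statement).**  `own i τ ω ≤ wabs i s · exp(cg · cost i s)`, `s = shape i τ`. [folklore] -/
def OwnFactorBound (wabs : Fin n → σ → ℝ) (cg : ℝ) : Prop :=
  ∀ i : Fin n, ∀ τ ∈ T, Φ.pend i τ = true → ∀ ω,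
    X.own i τ ω ≤ wabs i (shape i τ) * Real.exp (cg * cost i (shape i τ))

/-- **E2-rel (a) EXTERIOR RELATIVE LOCALITY (hypothesis shape; NOT PRINTED — printed inputs are the localized uniform
two-sided action bounds [Balaban1988Convergent] Thm 2 (2.43)/(2.44) p. 263 and B16 (1.99)/(1.100), which bound each
family of terms meeting the territory, not their ratio).**  `extWith i τ ω ≤ exp(ca · cost i s) · extWithout i τ ω` for
every exterior datum. [folklore] -/
def ExteriorRelLocality (ca : ℝ) : Prop :=
  ∀ i : Fin n, ∀ τ ∈ T, Φ.pend i τ = true → ∀ ω,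
    X.extWith i τ ω ≤ Real.exp (ca * cost i (shape i τ)) * X.extWithout i τ ω

/-- **E2-rel (b) TERRITORY CONDITIONAL LOWER BOUND (hypothesis shape; NOT PRINTED, NOT ASSERTED — the object of row
T4-U5.E-a-E2REL-b°).**  For every term pending at `i` and EVERY exterior datum `ω`:
`exp(−(cb · cost i s + slack i s)) · norm i τ ω ≤ terr i τ ω` — the context's conditional small-field integral over the
territory is at least the reference normalisation the pending operation divides out, up to a d′-relative loss `cb ·
cost` with `cb` INDEPENDENT of the cutoff, the run, the source parameter, the context and `ω`, and a NAMED SLACK `slack i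
s ≥ 0`-intended (the final-step Haar-vs-Gaussian normalisation mismatch of the territory; NOT asserted to vanish — see
`SlackDPrime`).  Printed relatives: the GLOBAL lower bound (2.50) p. 264 (whole torus, all-small-field event,
g_k-dependent constants) and the operation-level (1.74) p. 380; neither is conditional or per territory. [folklore] -/
def TerritoryLowerBound (cb : ℝ) (slack : Fin n → σ → ℝ) : Prop :=
  ∀ i : Fin n, ∀ τ ∈ T, Φ.pend i τ = true → ∀ ω,
    Real.exp (-(cb * cost i (shape i τ) + slack i (shape i τ))) * X.norm i τ ω ≤ X.terr i τ ω

/-- **E2-rel (b), TWO-SIDED form (hypothesis shape; NOT PRINTED)** — the row's «two-sided bound, uniform in K and in the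
exterior»: the lower half is what fibre DOMINATION consumes (`TerritoryComparison.lower`); the upper half is what a lower
bound on the insertion ratio would consume. [folklore] -/
def TerritoryComparison (cb : ℝ) (slack : Fin n → σ → ℝ) : Prop :=
  ∀ i : Fin n, ∀ τ ∈ T, Φ.pend i τ = true → ∀ ω,
    Real.exp (-(cb * cost i (shape i τ) + slack i (shape i τ))) * X.norm i τ ω ≤ X.terr i τ ω ∧
    X.terr i τ ω ≤ Real.exp (cb * cost i (shape i τ) + slack i (shape i τ)) * X.norm i τ ω

variable {Φ X shape cost}

/-- The two-sided comparison contains the lower bound. [folklore] -/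
theorem TerritoryComparison.lower {cb : ℝ} {slack : Fin n → σ → ℝ} (h : TerritoryComparison Φ X shape cost cb slack) :
    TerritoryLowerBound Φ X shape cost cb slack :=
  fun i τ hτ hp ω => (h i τ hτ hp ω).1

/-- **THE RECOMBINATION, fibrewise: (F1) ∧ E2-rel (a) ∧ E2-rel (b) ⇒ `FibrewiseRatio`** with the context-free price
`y i s = wabs i s · exp((cg + ca + cb) · cost i s + slack i s)` (pointwise real arithmetic in each fibre: bound `extWith`
by (a), `own` by (F1), `norm` by (b), reassemble `dens (off i τ)`). [folklore] -/
theorem fibrewise_of_territory {wabs : Fin n → σ → ℝ} {cg ca cb : ℝ} {slack : Fin n → σ → ℝ}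
    (hw : ∀ i, ∀ τ ∈ T, Φ.pend i τ = true → 0 ≤ wabs i (shape i τ))
    (hF1 : OwnFactorBound Φ X shape cost wabs cg) (ha : ExteriorRelLocality Φ X shape cost ca)
    (hb : TerritoryLowerBound Φ X shape cost cb slack) :
    FibrewiseRatio Φ F shape fun i s => wabs i s * Real.exp ((cg + ca + cb) * cost i s + slack i s) := by
  intro i τ hτ hp ω
  set s := shape i τ with hs
  have hC := X.common_nonneg i τ hτ ω
  have hN := X.norm_nonneg i τ hτ ω
  have hO := X.own_nonneg i τ hτ ω
  have hEo := X.extWithout_nonneg i τ hτ ω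
  have h1 : X.extWith i τ ω ≤ Real.exp (ca * cost i s) * X.extWithout i τ ω := ha i τ hτ hp ω
  have h2 : X.own i τ ω ≤ wabs i s * Real.exp (cg * cost i s) := hF1 i τ hτ hp ω
  have h3 : X.norm i τ ω ≤ Real.exp (cb * cost i s + slack i s) * X.terr i τ ω := by
    have h := hb i τ hτ hp ω
    have hpos : 0 < Real.exp (cb * cost i s + slack i s) := Real.exp_pos _
    rw [Real.exp_neg] at h
    calc X.norm i τ ω
        = Real.exp (cb * cost i s + slack i s) * ((Real.exp (cb * cost i s + slack i s))⁻¹ * X.norm i τ ω) := by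
          rw [← mul_assoc, mul_inv_cancel₀ hpos.ne', one_mul]
      _ ≤ Real.exp (cb * cost i s + slack i s) * X.terr i τ ω := mul_le_mul_of_nonneg_left h hpos.le
  have hexp : wabs i s * Real.exp ((cg + ca + cb) * cost i s + slack i s) =
      Real.exp (ca * cost i s) * (wabs i s * Real.exp (cg * cost i s)) * Real.exp (cb * cost i s + slack i s) := by
    have : (cg + ca + cb) * cost i s + slack i s = ca * cost i s + cg * cost i s + (cb * cost i s + slack i s) := by
      ring
    rw [this, Real.exp_add, Real.exp_add]
    ring
  rw [X.dens_pend i τ hτ hp ω, X.dens_off i τ hτ hp ω]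
  dsimp only
  rw [hexp]
  calc X.common i τ ω * X.extWith i τ ω * (X.norm i τ ω * X.own i τ ω)
      ≤ X.common i τ ω * (Real.exp (ca * cost i s) * X.extWithout i τ ω) * (X.norm i τ ω * X.own i τ ω) :=
        mul_le_mul_of_nonneg_right (mul_le_mul_of_nonneg_left h1 hC) (mul_nonneg hN hO)
    _ ≤ X.common i τ ω * (Real.exp (ca * cost i s) * X.extWithout i τ ω) *
          (X.norm i τ ω * (wabs i s * Real.exp (cg * cost i s))) :=
        mul_le_mul_of_nonneg_left (mul_le_mul_of_nonneg_left h2 hN)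
          (mul_nonneg hC (mul_nonneg (Real.exp_pos _).le hEo))
    _ ≤ X.common i τ ω * (Real.exp (ca * cost i s) * X.extWithout i τ ω) *
          (Real.exp (cb * cost i s + slack i s) * X.terr i τ ω * (wabs i s * Real.exp (cg * cost i s))) :=
        mul_le_mul_of_nonneg_left
          (mul_le_mul_of_nonneg_right h3 (mul_nonneg (hw i τ hτ hp) (Real.exp_pos _).le))
          (mul_nonneg hC (mul_nonneg (Real.exp_pos _).le hEo))
    _ = Real.exp (ca * cost i s) * (wabs i s * Real.exp (cg * cost i s)) * Real.exp (cb * cost i s + slack i s) *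
          (X.common i τ ω * X.extWithout i τ ω * X.terr i τ ω) := by ring

/-- **THE RECOMBINATION: (F1) ∧ E2-rel (a) ∧ E2-rel (b) ⇒ (EN) `PointwiseRatio`** with price
`y i s = wabs i s · exp((cg + ca + cb) · cost i s + slack i s)` — the (EN) field of `T4InsertionProfile.PointDom` for
this run at this `(K, t)`, to be fed to `single_slot_of_pointwise` with the entropy arithmetic of `T4InsertionProfile`
§3 unchanged (the price has the printed type: decay `wabs` times growth exponential in the d′-cost). [folklore] -/
theorem pointwiseRatio_of_territory {wabs : Fin n → σ → ℝ} {cg ca cb : ℝ} {slack : Fin n → σ → ℝ}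
    (hw : ∀ i, ∀ τ ∈ T, Φ.pend i τ = true → 0 ≤ wabs i (shape i τ))
    (hF1 : OwnFactorBound Φ X shape cost wabs cg) (ha : ExteriorRelLocality Φ X shape cost ca)
    (hb : TerritoryLowerBound Φ X shape cost cb slack) :
    PointwiseRatio Φ A shape fun i s => wabs i s * Real.exp ((cg + ca + cb) * cost i s + slack i s) :=
  pointwiseRatio_of_fibrewise Φ F (fibrewise_of_territory hw hF1 ha hb)

/-- **SLACK IN THE d′-BUDGET (hypothesis shape; print's own currency for a per-site normalisation mismatch, p. 380:
«every large field domain Z_j contributes the constant O(1) log g_j^{−2}|Z_j| ≤ … ≤ O(1)M^dR_j^{d+1}d′_j(Z_j)»; whether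
the final-step Haar-vs-Gaussian mismatch of a TERRITORY is so absorbed is part of row E2REL-b°, NOT asserted).**
`slack i s ≤ cm · cost i s` on the shapes of pending terms. [folklore] -/
def SlackDPrime (Φ : SwitchOff T n) (shape : Fin n → ι → σ) (cost : Fin n → σ → ℝ) (slack : Fin n → σ → ℝ)
    (cm : ℝ) : Prop :=
  ∀ i : Fin n, ∀ τ ∈ T, Φ.pend i τ = true → slack i (shape i τ) ≤ cm * cost i (shape i τ)

/-- **With the slack folded into the d′-budget** the price is `wabs i s · exp((cg + ca + cb + cm) · cost i s)` — the
shape the referee record prescribes (t4/T4-REF-U5.md §8: d′-relative, constant booked in the κ-budget of p. 386 shared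
with the remnant row). [folklore] -/
theorem pointwiseRatio_of_territory_dPrime {wabs : Fin n → σ → ℝ} {cg ca cb cm : ℝ} {slack : Fin n → σ → ℝ}
    (hA : ∀ τ ∈ T, 0 ≤ A τ) (hw : ∀ i, ∀ τ ∈ T, Φ.pend i τ = true → 0 ≤ wabs i (shape i τ))
    (hF1 : OwnFactorBound Φ X shape cost wabs cg) (ha : ExteriorRelLocality Φ X shape cost ca)
    (hb : TerritoryLowerBound Φ X shape cost cb slack) (hm : SlackDPrime Φ shape cost slack cm) :
    PointwiseRatio Φ A shape fun i s => wabs i s * Real.exp ((cg + ca + cb + cm) * cost i s) := by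
  refine pointwiseRatio_mono Φ hA (fun i τ hτ hp => ?_) (pointwiseRatio_of_territory hw hF1 ha hb)
  refine mul_le_mul_of_nonneg_left (Real.exp_le_exp.2 ?_) (hw i τ hτ hp)
  have := hm i τ hτ hp
  nlinarith [this]

/-- Fibre weights of a fibre model are non-negative (so `pointwiseRatio_of_territory_dPrime`'s first binder is
automatic). [folklore] -/
theorem FibreModel.weight_nonneg (F : FibreModel T A μ) : ∀ τ ∈ T, 0 ≤ A τ := fun τ hτ => by
  rw [F.repr τ hτ]; exact integral_nonneg (F.nonneg τ hτ)

/-- FAITHFULNESS (construction): ANY fibre model satisfying a fibrewise ratio bound carries the TAUTOLOGICAL territory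
factorisation — common factor = the context's density, exterior factors = reference normalisation = territory integral
= 1, own factor = the actual fibre ratio (0 where the context density vanishes). [folklore] -/
noncomputable def TerritoryFactorisation.ofFibrewise (Φ : SwitchOff T n) (F : FibreModel T A μ)
    (shape : Fin n → ι → σ) (y : Fin n → σ → ℝ) (h : FibrewiseRatio Φ F shape y) :
    TerritoryFactorisation Φ F where
  common i τ ω := F.dens (Φ.off i τ) ω
  extWith _ _ _ := 1
  extWithout _ _ _ := 1
  norm _ _ _ := 1
  own i τ ω := if F.dens (Φ.off i τ) ω = 0 then 0 else F.dens τ ω / F.dens (Φ.off i τ) ω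
  terr _ _ _ := 1
  common_nonneg i τ hτ ω := F.nonneg _ (Φ.off_mem i τ hτ) ω
  extWithout_nonneg _ _ _ _ := zero_le_one
  norm_nonneg _ _ _ _ := zero_le_one
  own_nonneg i τ hτ ω := by
    show 0 ≤ (if F.dens (Φ.off i τ) ω = 0 then 0 else F.dens τ ω / F.dens (Φ.off i τ) ω)
    split_ifs with h0
    · exact le_rfl
    · exact div_nonneg (F.nonneg τ hτ ω) (F.nonneg _ (Φ.off_mem i τ hτ) ω)
  dens_pend i τ hτ hp ω := by
    show F.dens τ ω = F.dens (Φ.off i τ) ω * 1 *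
      (1 * (if F.dens (Φ.off i τ) ω = 0 then 0 else F.dens τ ω / F.dens (Φ.off i τ) ω))
    split_ifs with h0
    · have h1 := h i τ hτ hp ω
      rw [h0, mul_zero] at h1
      have h2 := F.nonneg τ hτ ω
      have : F.dens τ ω = 0 := le_antisymm h1 h2
      rw [this]; ring
    · field_simp
  dens_off i τ _ _ ω := by
    show F.dens (Φ.off i τ) ω = F.dens (Φ.off i τ) ω * 1 * 1
    ring

/-- FAITHFULNESS (statement): on the tautological factorisation (F1) holds with `wabs = y`, `cg = 0`, and E2-rel (a),
E2-rel (b) hold two-sidedly with `ca = cb = 0`, zero slack, for ANY cost — so the split (F1) ∧ (a) ∧ (b) loses nothing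
against `FibrewiseRatio`, and given the printed (F1) the entire unprinted content of the conditional ratio is the pair
(a) ∧ (b). [folklore] -/
theorem territory_of_fibrewise (Φ : SwitchOff T n) (F : FibreModel T A μ) (shape : Fin n → ι → σ)
    (cost : Fin n → σ → ℝ) (y : Fin n → σ → ℝ) (hy : ∀ i, ∀ τ ∈ T, Φ.pend i τ = true → 0 ≤ y i (shape i τ))
    (h : FibrewiseRatio Φ F shape y) :
    OwnFactorBound Φ (TerritoryFactorisation.ofFibrewise Φ F shape y h) shape cost y 0 ∧
    ExteriorRelLocality Φ (TerritoryFactorisation.ofFibrewise Φ F shape y h) shape cost 0 ∧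
    TerritoryComparison Φ (TerritoryFactorisation.ofFibrewise Φ F shape y h) shape cost 0 fun _ _ => 0 := by
  classical
  refine ⟨fun i τ hτ hp ω => ?_, fun i τ _ _ ω => by simp [TerritoryFactorisation.ofFibrewise],
    fun i τ _ _ ω => by simp [TerritoryFactorisation.ofFibrewise]⟩
  simp only [TerritoryFactorisation.ofFibrewise, zero_mul, Real.exp_zero, mul_one]
  split_ifs with h0
  · exact hy i τ hτ hp
  · rw [div_le_iff₀ (lt_of_le_of_ne (F.nonneg _ (Φ.off_mem i τ hτ) ω) (Ne.symm h0))]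
    exact h i τ hτ hp ω

end Territory

/-! ## §2′ The d′-cost currency and p. 380's conversion of a per-site mismatch (arithmetic only) -/

section Currency

/-- **THE d′-COST of a layered structure** (the cell's currency, record t4/T4-REF-U5.md §8; the debit «− O(1)M^dR^{d+1}
_{j+1}d′_{j+1}(Z)» of κ_{j+1}(Z), [Balaban1989LargeFieldII] p. 386): `Σ_{n ∈ [j, K]} M^d · R n^{d+1} · (d′ n + 1)` for a
structure alive at the steps `j … K` with linear sizes `d′ n` (in MR_n-cubes) and block constants `M`, `R n`.
[folklore] -/
noncomputable def dPrimeCost (d : ℕ) (M : ℝ) (R : ℕ → ℝ) (dprime : ℕ → ℝ) (j K : ℕ) : ℝ :=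
  ∑ m ∈ Finset.Icc j K, M ^ d * R m ^ (d + 1) * (dprime m + 1)

/-- The d′-cost is non-negative for `M, R ≥ 0`, `d′ ≥ 0`. [folklore] -/
theorem dPrimeCost_nonneg {d : ℕ} {M : ℝ} {R dprime : ℕ → ℝ} (hM : 0 ≤ M) (hR : ∀ m, 0 ≤ R m)
    (hd : ∀ m, 0 ≤ dprime m) (j K : ℕ) : 0 ≤ dPrimeCost d M R dprime j K :=
  Finset.sum_nonneg fun m _ => mul_nonneg (mul_nonneg (pow_nonneg hM _) (pow_nonneg (hR m) _))
    (by linarith [hd m])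

/-- **p. 380's CONVERSION as arithmetic**: a VOLUME-proportional mismatch `c₀ · ℓ · vol` (ℓ = log g^{−2} per site, `vol`
= sites of the domain at that scale) with `vol ≤ (M·R)^d · (d′ + 1)` (a union of at most `d′ + 1` MR-cubes) and
`ℓ ≤ R` ([Balaban1988Convergent] (2.5) p. 255 [p013, read]: «R_j is the smallest number of the form L^r such, that
R_j ≥ (log g_j^{−2})^r», so log g_j^{−2} ≤ R_j once log g_j^{−2} ≥ 1) is d′-RELATIVE:
`≤ c₀ · M^d · R^{d+1} · (d′ + 1)`.  So even WITHOUT any interior cancellation the territory mismatch is in the currency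
of `SlackDPrime` — K-uniformly when the final-step coupling is the renormalised one (g_K = g; record §8.2 (i)).
[folklore] -/
theorem volumeSlack_le_dPrime {c₀ ℓ vol M R dprime : ℝ} {d : ℕ} (hc : 0 ≤ c₀) (hℓ0 : 0 ≤ ℓ) (hℓ : ℓ ≤ R)
    (hvol : vol ≤ (M * R) ^ d * (dprime + 1)) (hvol0 : 0 ≤ vol) :
    c₀ * ℓ * vol ≤ c₀ * M ^ d * R ^ (d + 1) * (dprime + 1) := by
  have hR : 0 ≤ R := hℓ0.trans hℓ
  calc c₀ * ℓ * vol ≤ c₀ * R * ((M * R) ^ d * (dprime + 1)) := by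
        apply mul_le_mul (mul_le_mul_of_nonneg_left hℓ hc) hvol hvol0 (mul_nonneg hc hR)
    _ = c₀ * M ^ d * R ^ (d + 1) * (dprime + 1) := by rw [mul_pow]; ring

/-- One summand of the d′-cost dominates a volume-type mismatch at that step (so a per-step family of such mismatches is
dominated by `c₀ · dPrimeCost`). [folklore] -/
theorem sum_volumeSlack_le_dPrimeCost {d : ℕ} {c₀ M : ℝ} {R dprime ℓ vol : ℕ → ℝ} (hc : 0 ≤ c₀)
    (hℓ0 : ∀ m, 0 ≤ ℓ m) (hℓ : ∀ m, ℓ m ≤ R m) (hvol0 : ∀ m, 0 ≤ vol m)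
    (hvol : ∀ m, vol m ≤ (M * R m) ^ d * (dprime m + 1)) (j K : ℕ) :
    ∑ m ∈ Finset.Icc j K, c₀ * ℓ m * vol m ≤ c₀ * dPrimeCost d M R dprime j K := by
  unfold dPrimeCost
  rw [Finset.mul_sum]
  refine Finset.sum_le_sum fun m _ => ?_
  have h := volumeSlack_le_dPrime (d := d) hc (hℓ0 m) (hℓ m) (hvol m) (hvol0 m)
  calc c₀ * ℓ m * vol m ≤ c₀ * M ^ d * R m ^ (d + 1) * (dprime m + 1) := h
    _ = c₀ * (M ^ d * R m ^ (d + 1) * (dprime m + 1)) := by ring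

end Currency

/-! ## §3 Sanity: the independent-structure model over a one-point exterior carries a territory factorisation with
EQUALITY in (a) and (b) and zero cost -/

section Product

variable {n : ℕ}

/-- The Dirac fibre model of the independent-structure weights: exterior data = one point, density = the weight.
[folklore] -/
noncomputable def productFibre (a₀ : ℝ) (u : Fin n → ℝ) (ha : 0 ≤ a₀) (hu : ∀ i, 0 ≤ u i) :
    FibreModel (Finset.univ : Finset (Fin n → Bool)) (productWeight a₀ u) (Measure.dirac ()) where
  dens τ _ := productWeight a₀ u τ
  repr τ _ := by rw [integral_dirac]
  integrable τ _ := Integrable.of_finite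
  nonneg τ _ _ := productWeight_nonneg ha hu τ

/-- In the independent model a pending pattern's weight is its slot factor times its context's weight. [folklore] -/
theorem productWeight_pend {a₀ : ℝ} {u : Fin n → ℝ} {τ : Fin n → Bool} {i : Fin n} (hi : τ i = true) :
    productWeight a₀ u τ = u i * productWeight a₀ u (Function.update τ i false) := by
  have h := productWeight_update_true (a₀ := a₀) (u := u) (τ := Function.update τ i false) (i := i) (by simp)
  rw [Function.update_idem, ← hi, Function.update_eq_self] at h
  exact h

/-- The territory factorisation of the independent model: common factor = the context's weight, exterior factors = 1,
reference normalisation = territory integral = 1 (IDENTICAL cancellation), own factor = the slot activity. [folklore] -/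
noncomputable def productTerritory (a₀ : ℝ) (u : Fin n → ℝ) (ha : 0 ≤ a₀) (hu : ∀ i, 0 ≤ u i) :
    TerritoryFactorisation (productSwitchOff n) (productFibre a₀ u ha hu) where
  common i τ _ := productWeight a₀ u (Function.update τ i false)
  extWith _ _ _ := 1
  extWithout _ _ _ := 1
  norm _ _ _ := 1
  own i _ _ := u i
  terr _ _ _ := 1
  common_nonneg i τ _ _ := productWeight_nonneg ha hu _
  extWithout_nonneg _ _ _ _ := zero_le_one
  norm_nonneg _ _ _ _ := zero_le_one
  own_nonneg i _ _ _ := hu i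
  dens_pend i τ _ hp _ := by
    change productWeight a₀ u τ = _
    rw [productWeight_pend (show τ i = true from hp)]
    ring
  dens_off i τ _ _ _ := by
    change productWeight a₀ u (Function.update τ i false) = _
    ring

/-- **THE HYPOTHESIS SET IS INHABITED NON-VACUOUSLY**: in the independent model (one-point shape type, zero cost, zero
slack) (F1) holds with `wabs = u`, E2-rel (a) with `ca = 0`, E2-rel (b) two-sidedly with `cb = 0` — all with EQUALITY —
and the recombined price is exactly the slot activity `u i`. [folklore] -/
theorem pointwiseRatio_product_territory (a₀ : ℝ) (u : Fin n → ℝ) (ha : 0 ≤ a₀) (hu : ∀ i, 0 ≤ u i) :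
    OwnFactorBound (productSwitchOff n) (productTerritory a₀ u ha hu) (fun _ _ => ()) (fun _ _ => 0)
        (fun i _ => u i) 0 ∧
    ExteriorRelLocality (productSwitchOff n) (productTerritory a₀ u ha hu) (fun _ _ => ()) (fun _ _ => 0) 0 ∧
    TerritoryComparison (productSwitchOff n) (productTerritory a₀ u ha hu) (fun _ _ => ()) (fun _ _ => 0) 0
        (fun _ _ => 0) ∧
    PointwiseRatio (productSwitchOff n) (productWeight a₀ u) (fun (_ : Fin n) (_ : Fin n → Bool) => ())
        fun i _ => u i := by
  refine ⟨fun i τ _ _ _ => by simp [productTerritory], fun i τ _ _ _ => by simp [productTerritory],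
    fun i τ _ _ _ => by simp [productTerritory], ?_⟩
  have h := pointwiseRatio_of_territory (Φ := productSwitchOff n) (X := productTerritory a₀ u ha hu)
    (shape := fun _ _ => ()) (cost := fun _ _ => (0 : ℝ)) (wabs := fun i _ => u i) (cg := 0) (ca := 0) (cb := 0)
    (slack := fun _ _ => 0) (fun i _ _ _ => hu i) (fun i τ _ _ _ => by simp [productTerritory])
    (fun i τ _ _ _ => by simp [productTerritory]) (fun i τ _ _ _ => by simp [productTerritory])
  simpa using h

end Product

end Literature.MathematicalPhysics.QuantumFieldTheory.Balaban1983to89.T4TerritoryComparison
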